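import Literature.NumberTheory.Transcendental.MZVDualIndex
import HarnessLib

/-!
# Multiple zeta values — the duals of the Hoffman elements lie in the Hoffman span

Sibling proof file of `Literature.NumberTheory.Transcendental.MultipleZetaValues` (D-0014), in the
cone of the named fact `hoffmanSpan_eq_mzvSpace` (Brown 2012, Theorem 1.1). Hoffman's duality
`ζ(τ(s)) = ζ(s)` (Hoffman 1992, §3; a theorem by Kontsevich's integral formula, tree:
`multipleZeta_duality`) maps the Hoffman words `{2,3}^×` onto the words in the two blocks
`(2)` and `(2,1)`: on binary words `τ` reverses and exchanges `0 ↔ 1`, so `ε(2) = 01 ↦ 01 = ε(2)`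
and `ε(3) = 001 ↦ 011 = ε(2,1)`, blockwise in reverse order. Hence (all weights):

* `multipleZeta_twoBlocks_eq` : for every word `u` in the blocks `(2)`, `(2,1)` (coded by
  `u : List Bool`, `false ↦ (2)`, `true ↦ (2,1)`), `ζ(u) = ζ(h(u))` where `h(u) ∈ {2,3}^×` is `u`
  read backwards with `(2) ↦ 2`, `(2,1) ↦ 3`; e.g. `ζ({2,1}ⁿ) = ζ({3}ⁿ)` (`multipleZeta_twoOne`),
  `ζ(2,2,1) = ζ(3,2)`, `ζ(2,1,2) = ζ(2,3)`;
* `multipleZeta_twoBlocks_mem_hoffmanSpan` : **every such `ζ(u)` lies in `hoffmanSpan (weight u)`**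
  — Brown's theorem `hoffmanSpan_eq_mzvSpace` for the `2^k` indices of each length `k` in the
  blocks `(2)`, `(2,1)` (the "dual Hoffman family"), unconditionally.

No definitions and no named facts are introduced (pure proofs, D-0026).

## References

* M. E. Hoffman, *Multiple harmonic series*, Pacific J. Math. **152** (1992), 275–290, §3
  (duality), p. 281. [Hoffman1992]
* F. Brown, *Mixed Tate motives over ℤ*, Ann. of Math. **175** (2012), 949–976, Theorem 1.1.
  [Brown2012]
-/

namespace Literature.NumberTheory.Transcendental

namespace MZV

/-- `ε(s t) = ε(s) ε(t)`: the binary word of a concatenation. [folklore] -/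
theorem binaryWord_append (s t : List ℕ) : binaryWord (s ++ t) = binaryWord s ++ binaryWord t := by
  induction s with
  | nil => rfl
  | cons a s ih => simp [binaryWord, ih]

/-- **The binary word of a word in the blocks `(2)`, `(2,1)` is the reversed-and-complemented word
of the Hoffman word `h(u)`** (`u` backwards, `(2) ↦ 2`, `(2,1) ↦ 3`): `ε(2) = 01 = τ(01)`,
`ε(2,1) = 011 = τ(001) = τ(ε(3))`. [cite: Hoffman1992, §3 p. 281] -/
theorem binaryWord_twoBlocks (u : List Bool) :
    binaryWord ((u.map fun b => if b then [2, 1] else [2]).flatten) =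
      (binaryWord (u.reverse.map fun b => if b then 3 else 2)).reverse.map fun b => !b := by
  induction u with
  | nil => rfl
  | cons b u ih =>
    rw [List.map_cons, List.flatten_cons, binaryWord_append, ih, List.reverse_cons, List.map_append,
      List.map_singleton, binaryWord_append, List.reverse_append, List.map_append]
    cases b <;> rfl

/-- Words in the blocks `(2)`, `(2,1)` are admissible. [folklore] -/
theorem isAdmissible_twoBlocks (u : List Bool) :
    IsAdmissible ((u.map fun b => if b then [2, 1] else [2]).flatten) := by
  refine ⟨fun i hi => ?_, fun h => ?_⟩
  · simp only [List.mem_flatten, List.mem_map] at hi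
    obtain ⟨l, ⟨b, -, rfl⟩, hil⟩ := hi
    cases b <;> simp at hil <;> omega
  · cases u with
    | nil => exact absurd rfl h
    | cons b u => cases b <;> simp

/-- The Hoffman word `h(u)` is a Hoffman index. [folklore] -/
theorem isHoffman_hoffmanOfBlocks (u : List Bool) :
    IsHoffman (u.reverse.map fun b => if b then 3 else 2) := by
  intro i hi
  simp only [List.mem_map, List.mem_reverse] at hi
  obtain ⟨b, -, rfl⟩ := hi
  cases b <;> simp

end MZV

open MZV

/-- **Duality for the blocks `(2)`, `(2,1)`**: `ζ(u) = ζ(h(u))` for every word `u` in the blocks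
`(2)`, `(2,1)`, where `h(u) ∈ {2,3}^×` is `u` read backwards with `(2) ↦ 2`, `(2,1) ↦ 3`
(Hoffman's duality, Hoffman 1992, §3; `multipleZeta_duality`). [cite: Hoffman1992, §3 p. 282] -/
theorem multipleZeta_twoBlocks_eq (u : List Bool) :
    multipleZeta ((u.map fun b => if b then [2, 1] else [2]).flatten) =
      multipleZeta (u.reverse.map fun b => if b then 3 else 2) :=
  multipleZeta_duality (isHoffman_hoffmanOfBlocks u).isAdmissible (isAdmissible_twoBlocks u)
    (binaryWord_twoBlocks u)

/-- The weights agree: `weight u = weight h(u)`. [folklore] -/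
theorem weight_twoBlocks_eq (u : List Bool) :
    weight ((u.map fun b => if b then [2, 1] else [2]).flatten) =
      weight (u.reverse.map fun b => if b then 3 else 2) :=
  weight_eq_of_binaryWord_eq_dual (isHoffman_hoffmanOfBlocks u).isAdmissible
    (isAdmissible_twoBlocks u) (binaryWord_twoBlocks u)

/-- **The dual Hoffman family lies in the Hoffman span** (all weights): for every word `u` in the
blocks `(2)` and `(2,1)`, `ζ(u) ∈ hoffmanSpan (weight u)` — Brown's theorem
`hoffmanSpan_eq_mzvSpace` (Theorem 1.1) for these `2^k` indices of each length `k`, by duality.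
[cite: Brown2012, Theorem 1.1] -/
theorem multipleZeta_twoBlocks_mem_hoffmanSpan (u : List Bool) :
    multipleZeta ((u.map fun b => if b then [2, 1] else [2]).flatten) ∈
      hoffmanSpan (weight ((u.map fun b => if b then [2, 1] else [2]).flatten)) := by
  rw [multipleZeta_twoBlocks_eq, weight_twoBlocks_eq]
  exact Submodule.subset_span ⟨_, isHoffman_hoffmanOfBlocks u, rfl, rfl⟩

/-- `{2,1}ⁿ` as a block word. [folklore] -/
theorem twoOne_eq_twoBlocks (n : ℕ) :
    (List.replicate n [2, 1]).flatten =
      ((List.replicate n true).map fun b => if b then [2, 1] else [2]).flatten := by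
  rw [List.map_replicate]
  rfl

/-- **`ζ({2,1}ⁿ) = ζ({3}ⁿ)`**, i.e. `ζ(2,1,2,1,…,2,1) = ζ(3,3,…,3)` for every `n` (duality;
`n = 1` is Euler's `ζ(2,1) = ζ(3)`). [cite: Hoffman1992, §3 p. 282] -/
theorem multipleZeta_twoOne (n : ℕ) :
    multipleZeta (List.replicate n [2, 1]).flatten = multipleZeta (List.replicate n 3) := by
  rw [twoOne_eq_twoBlocks, multipleZeta_twoBlocks_eq, List.reverse_replicate, List.map_replicate]
  rfl

/-- `ζ({2,1}ⁿ) ∈ hoffmanSpan (3n)` for every `n`. [cite: Brown2012, Theorem 1.1] -/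
theorem multipleZeta_twoOne_mem_hoffmanSpan (n : ℕ) :
    multipleZeta (List.replicate n [2, 1]).flatten ∈ hoffmanSpan (3 * n) := by
  rw [multipleZeta_twoOne]
  refine Submodule.subset_span ⟨_, fun i hi => Or.inr (List.eq_of_mem_replicate hi), ?_, rfl⟩
  simp [weight, List.sum_replicate, mul_comm]

/-- Examples: `ζ(2,2,1) = ζ(3,2)`, `ζ(2,1,2) = ζ(2,3)`, `ζ(2,1,2,2,1) = ζ(3,2,3)`. [folklore] -/
example : multipleZeta [2, 2, 1] = multipleZeta [3, 2] ∧ multipleZeta [2, 1, 2] = multipleZeta [2, 3] ∧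
    multipleZeta [2, 1, 2, 2, 1] = multipleZeta [3, 2, 3] :=
  ⟨multipleZeta_twoBlocks_eq [false, true], multipleZeta_twoBlocks_eq [true, false],
    multipleZeta_twoBlocks_eq [true, false, true]⟩

end Literature.NumberTheory.Transcendental
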